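import Summits.AtomisticToContinuum.BoseEinsteinCondensation.Theorems.BECThomsonPrincipleGDTransferBareSecondVariationSlotDeriv

/-!
# Route `BECThomsonPrinciple`, crux `GDTransfer` (stmt-AtomisticToContinuum-9482), line `dyson-dressed-witness`:
# stub `bareSecondVariation`, part 2 — `∂_{j,a}` through `Q_S`, `n̂₀^{-1/2}`, `Λ_n†`, `Λ_n`

Support file of `stub_bareSecondVariation`, continuing part 1 (`…BareSecondVariationSlotDeriv`).  Since
`∂_{j,a}` commutes with every cell average `P_i` on periodic `C¹` functions, it commutes with the mode
projections `Q_S` (`fderiv_modeProj_single`) and with `R = n̂₀^{-1/2} = Σ_{S≠∅}|S|^{-1/2}Q_S`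
(`fderiv_rootInv_single`); with the plane-wave derivative `∂_{j,a} e_n(x_i) = δ_{ij} (2πi n_a/L) e_n(x_i)`
(`PeriodicTorusByParts`) this gives the two LNSS derivative formulas
`∂_{j,a}(Λ_n† g) = (2πi n_a/L) e_n(x_j) P_j R g + Λ_n†(∂_{j,a} g)` (`fderiv_lnssUpper_single`) and
`∂_{j,a}(Λ_n f) = Λ_n(∂_{j,a} f) − (2πi n_a/L) R P_j^{(n)} f` (`fderiv_lnssLower_single`) for periodic `C¹`
`f, g` — the configuration-space form of `[∇, a_n†ã₀]` and `[∇, ã₀†a_n]`.  Also: linearity of `R` on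
continuous functions.  All [folklore] (arXiv:1211.2778 §2).
-/

noncomputable section

open MeasureTheory Filter
open scoped ENNReal NNReal ComplexConjugate

namespace Summit.AtomisticToContinuum.BoseEinsteinCondensation.Cruxes.GDTransfer.DysonDressedWitness

namespace SecondVariation

open Literature.MathematicalPhysics.QuantumManyBody.BoseGas
open Summit.AtomisticToContinuum.BoseEinsteinCondensation.Theorems.GaussianDominationCan.Negative
open ChordVariation (continuous_modeProj)
open Lnss

variable {N m : ℕ} {L : ℝ}

/-! ## `∂_{j,a}` through `Q_S`, `n̂₀^{-1/2}`, `Λ_n†`, `Λ_n` -/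

/-- The `foldr` commutes with `∂_{j,a}` on periodic `C¹` functions. [folklore] -/
theorem fderiv_foldr_single (hL : 0 < L) (S : Finset (Fin N)) (l : List (Fin N)) (j : Fin N)
    (a : Fin 3) {h : Config N → ℂ} (hh : ContDiff ℝ 1 h)
    (hper : ∀ (X : Config N) (i : Fin N) (k : Fin 3),
      h (X + Pi.single i (EuclideanSpace.single k L)) = h X) :
    (fun X => fderiv ℝ
        (l.foldr (fun i g => if i ∈ S then cellAvg N L i g else g - cellAvg N L i g) h) X
        (Pi.single j (EuclideanSpace.single a 1))) =
      l.foldr (fun i g => if i ∈ S then cellAvg N L i g else g - cellAvg N L i g)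
        (fun Y => fderiv ℝ h Y (Pi.single j (EuclideanSpace.single a 1))) := by
  induction l with
  | nil => rfl
  | cons b l ih =>
    have hc : ContDiff ℝ 1
        (l.foldr (fun i g => if i ∈ S then cellAvg N L i g else g - cellAvg N L i g) h) :=
      contDiff_foldr_cellAvg S l hh
    have hp := foldr_cellAvg_periodic (L := L) S l hper
    simp only [List.foldr_cons]
    rw [← ih]
    by_cases hbS : b ∈ S
    · simp only [if_pos hbS]
      funext X
      exact fderiv_cellAvg_single hL b j a hc hp X
    · simp only [if_neg hbS]
      funext X
      have hd1 : DifferentiableAt ℝ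
          (l.foldr (fun i g => if i ∈ S then cellAvg N L i g else g - cellAvg N L i g) h) X :=
        hc.differentiable one_ne_zero X
      have hd2 : DifferentiableAt ℝ (cellAvg N L b
          (l.foldr (fun i g => if i ∈ S then cellAvg N L i g else g - cellAvg N L i g) h)) X :=
        (contDiff_cellAvg b hc).differentiable one_ne_zero X
      rw [fderiv_sub hd1 hd2, FunLike.coe_sub, Pi.sub_apply, Pi.sub_apply,
        fderiv_cellAvg_single hL b j a hc hp X]

/-- **`Q_S` commutes with `∂_{j,a}`** on periodic `C¹` functions. [folklore] -/
theorem fderiv_modeProj_single (hL : 0 < L) (S : Finset (Fin N)) (j : Fin N) (a : Fin 3)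
    {h : Config N → ℂ} (hh : ContDiff ℝ 1 h)
    (hper : ∀ (X : Config N) (i : Fin N) (k : Fin 3),
      h (X + Pi.single i (EuclideanSpace.single k L)) = h X) :
    (fun X => fderiv ℝ (modeProj N L S h) X (Pi.single j (EuclideanSpace.single a 1))) =
      modeProj N L S (fun Y => fderiv ℝ h Y (Pi.single j (EuclideanSpace.single a 1))) :=
  fderiv_foldr_single hL S _ j a hh hper

/-- **`n̂₀^{-1/2}` commutes with `∂_{j,a}`** on periodic `C¹` functions. [folklore] -/
theorem fderiv_rootInv_single (hL : 0 < L) (j : Fin (m + 1)) (a : Fin 3)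
    {h : Config (m + 1) → ℂ} (hh : ContDiff ℝ 1 h)
    (hper : ∀ (X : Config (m + 1)) (i : Fin (m + 1)) (k : Fin 3),
      h (X + Pi.single i (EuclideanSpace.single k L)) = h X) :
    (fun X => fderiv ℝ (rootInv m L h) X (Pi.single j (EuclideanSpace.single a 1))) =
      rootInv m L (fun Y => fderiv ℝ h Y (Pi.single j (EuclideanSpace.single a 1))) := by
  funext X
  unfold rootInv
  rw [fderiv_finset_sum_apply _ (fun S _ =>
    ((contDiff_modeProj S hh).differentiable one_ne_zero X).const_mul _)]
  refine Finset.sum_congr rfl fun S _ => ?_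
  rw [fderiv_const_mul_apply' ((contDiff_modeProj S hh).differentiable one_ne_zero X),
    congrFun (fderiv_modeProj_single hL S j a hh hper) X]

/-- `n̂₀^{-1/2}` kills the zero function. [folklore] -/
theorem rootInv_zero : rootInv m L (fun _ => (0 : ℂ)) = fun _ => 0 := by
  funext X
  unfold rootInv
  refine Finset.sum_eq_zero fun S _ => ?_
  have h : modeProj (m + 1) L S (fun _ => (0 : ℂ)) = 0 := foldr_cellAvg_zero S _
  rw [h, Pi.zero_apply, mul_zero]

/-- `n̂₀^{-1/2}` is additive on continuous functions. [folklore] -/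
theorem rootInv_add {f g : Config (m + 1) → ℂ} (hf : Continuous f) (hg : Continuous g) :
    rootInv m L (fun X => f X + g X) = fun X => rootInv m L f X + rootInv m L g X := by
  funext X
  unfold rootInv
  rw [← Finset.sum_add_distrib]
  refine Finset.sum_congr rfl fun S _ => ?_
  have h : (fun X => f X + g X) = f + g := rfl
  rw [h, ChordVariation.modeProj_add S hf hg, Pi.add_apply, mul_add]

/-- `n̂₀^{-1/2}` is homogeneous. [folklore] -/
theorem rootInv_const_mul (c : ℂ) (g : Config (m + 1) → ℂ) :
    rootInv m L (fun X => c * g X) = fun X => c * rootInv m L g X := by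
  funext X
  unfold rootInv
  rw [Finset.mul_sum]
  refine Finset.sum_congr rfl fun S _ => ?_
  rw [ChordVariation.modeProj_const_mul S c g]
  ring

/-- `n̂₀^{-1/2}` through a difference with a scalar multiple (continuous functions). [folklore] -/
theorem rootInv_sub_const_mul {f g : Config (m + 1) → ℂ} (hf : Continuous f) (hg : Continuous g)
    (c : ℂ) :
    rootInv m L (fun X => f X - c * g X) = fun X => rootInv m L f X - c * rootInv m L g X := by
  have h1 : (fun X => f X - c * g X) = fun X => f X + (-c) * g X := by funext X; ring
  have hcg : Continuous fun X => (-c) * g X := continuous_const.mul hg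
  rw [h1, rootInv_add hf hcg, rootInv_const_mul]
  funext X
  ring

/-- The wave vector `k = 2πn/L` componentwise. [folklore] -/
theorem waveCoeff_eq (L : ℝ) (n : Fin 3 → ℤ) (a : Fin 3) :
    Complex.I * ((((2 * Real.pi / L) • latticeVec 1 n : Space) a : ℝ) : ℂ) =
      2 * Real.pi * Complex.I * (n a) / L := by
  simp only [latticeVec, PiLp.smul_apply, smul_eq_mul, one_mul]
  push_cast
  ring

/-- **Derivative of `Λ_n† g`**: `∂_{j,a}(Λ_n† g) = (2πi n_a/L) e_n(x_j) P_j n̂₀^{-1/2} g + Λ_n†(∂_{j,a} g)` for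
periodic `C¹` `g`. [folklore] -/
theorem fderiv_lnssUpper_single (hL : 0 < L) (n : Fin 3 → ℤ) (j : Fin (m + 1)) (a : Fin 3)
    {g : Config (m + 1) → ℂ} (hg : ContDiff ℝ 1 g)
    (hper : ∀ (X : Config (m + 1)) (i : Fin (m + 1)) (k : Fin 3),
      g (X + Pi.single i (EuclideanSpace.single k L)) = g X)
    (X : Config (m + 1)) :
    fderiv ℝ (lnssUpper m L n g) X (Pi.single j (EuclideanSpace.single a 1)) =
      (2 * Real.pi * Complex.I * (n a) / L) *
          (cellWave L n (X j) * cellAvg (m + 1) L j (rootInv m L g) X) +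
        lnssUpper m L n (fun Y => fderiv ℝ g Y (Pi.single j (EuclideanSpace.single a 1))) X := by
  have hR : ContDiff ℝ 1 (rootInv m L g) := contDiff_rootInv hg
  have hRp := rootInv_periodic (L := L) hper
  have hterm : ∀ i : Fin (m + 1),
      fderiv ℝ (fun Y => cellWave L n (Y i) * cellAvg (m + 1) L i (rootInv m L g) Y) X
          (Pi.single j (EuclideanSpace.single a 1)) =
        (if i = j then (2 * Real.pi * Complex.I * (n a) / L) * cellWave L n (X i) else 0) *
            cellAvg (m + 1) L i (rootInv m L g) X +
          cellWave L n (X i) * cellAvg (m + 1) L i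
            (rootInv m L (fun Y => fderiv ℝ g Y (Pi.single j (EuclideanSpace.single a 1)))) X := by
    intro i
    rw [fderiv_mul_apply (differentiable_cellWave_comp_apply L n i X)
        ((contDiff_cellAvg i hR).differentiable one_ne_zero X),
      fderiv_cellWave_comp_apply_single_single L n i j a X rfl, waveCoeff_eq,
      fderiv_cellAvg_single hL i j a hR hRp X, ← fderiv_rootInv_single hL j a hg hper]
  have hdiff : ∀ i ∈ (Finset.univ : Finset (Fin (m + 1))), DifferentiableAt ℝ
      (fun Y : Config (m + 1) => cellWave L n (Y i) * cellAvg (m + 1) L i (rootInv m L g) Y) X :=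
    fun i _ => (differentiable_cellWave_comp_apply L n i X).mul
      ((contDiff_cellAvg i hR).differentiable one_ne_zero X)
  unfold lnssUpper
  rw [fderiv_finset_sum_apply _ hdiff]
  simp only [hterm, Finset.sum_add_distrib, ite_mul, zero_mul, Finset.sum_ite_eq',
    Finset.mem_univ, if_true]
  ring

/-- **Derivative of `Λ_n f`**: `∂_{j,a}(Λ_n f) = Λ_n(∂_{j,a} f) − (2πi n_a/L) n̂₀^{-1/2} P_j^{(n)} f` for
periodic `C¹` `f` (`P_j^{(n)} f` is flat in slot `j`, and `P_j^{(n)} ∂_{j,a} = (2πi n_a/L) P_j^{(n)}`).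
[folklore] -/
theorem fderiv_lnssLower_single (hL : 0 < L) (n : Fin 3 → ℤ) (j : Fin (m + 1)) (a : Fin 3)
    {f : Config (m + 1) → ℂ} (hf : ContDiff ℝ 1 f)
    (hper : ∀ (X : Config (m + 1)) (i : Fin (m + 1)) (k : Fin 3),
      f (X + Pi.single i (EuclideanSpace.single k L)) = f X)
    (X : Config (m + 1)) :
    fderiv ℝ (lnssLower m L n f) X (Pi.single j (EuclideanSpace.single a 1)) =
      lnssLower m L n (fun Y => fderiv ℝ f Y (Pi.single j (EuclideanSpace.single a 1))) X -
        (2 * Real.pi * Complex.I * (n a) / L) * rootInv m L (fourierAvg m L n j f) X := by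
  have hh : ContDiff ℝ 1 (fun Y => ∑ i, fourierAvg m L n i f Y) :=
    ContDiff.sum fun i _ => contDiff_fourierAvg n i hf
  have hhp : ∀ (Y : Config (m + 1)) (i' : Fin (m + 1)) (k' : Fin 3),
      (∑ i, fourierAvg m L n i f (Y + Pi.single i' (EuclideanSpace.single k' L))) =
        ∑ i, fourierAvg m L n i f Y := fun Y i' k' =>
    Finset.sum_congr rfl fun i _ => fourierAvg_periodic n i hper Y i' k'
  have hder : (fun Y => fderiv ℝ (fun Z => ∑ i, fourierAvg m L n i f Z) Y
      (Pi.single j (EuclideanSpace.single a 1))) =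
      fun Y => (∑ i, fourierAvg m L n i
          (fun Z => fderiv ℝ f Z (Pi.single j (EuclideanSpace.single a 1))) Y) -
        (2 * Real.pi * Complex.I * (n a) / L) * fourierAvg m L n j f Y := by
    funext Y
    rw [fderiv_finset_sum_apply _ (fun i _ =>
      (contDiff_fourierAvg n i hf).differentiable one_ne_zero Y)]
    rw [← Finset.sum_erase_add _ _ (Finset.mem_univ j),
      ← Finset.sum_erase_add _ (fun i => fourierAvg m L n i
        (fun Z => fderiv ℝ f Z (Pi.single j (EuclideanSpace.single a 1))) Y) (Finset.mem_univ j),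
      fderiv_fourierAvg_single_self n j hf Y, fourierAvg_fderiv_single_self hL n j hf hper a Y,
      Finset.sum_congr rfl fun i hi =>
        fderiv_fourierAvg_single_of_ne n (Finset.ne_of_mem_erase hi).symm hf Y _]
    ring
  have hc1 : Continuous fun Y => ∑ i, fourierAvg m L n i
      (fun Z => fderiv ℝ f Z (Pi.single j (EuclideanSpace.single a 1))) Y :=
    continuous_finsetSum _ fun i _ => continuous_fourierAvg n i (continuous_fderiv_apply_const hf _)
  have hc2 : Continuous (fourierAvg m L n j f) := continuous_fourierAvg n j hf.continuous
  unfold lnssLower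
  rw [congrFun (fderiv_rootInv_single hL j a hh hhp) X, hder, rootInv_sub_const_mul hc1 hc2]

end SecondVariation

open Literature.MathematicalPhysics.QuantumManyBody.BoseGas in
/-- **Part 2 of `stub_bareSecondVariation` (registered helper statement)**: the derivative of the LNSS creator,
`∂_{j,a}(Λ_n† g) = (2πi n_a/L) e_n(x_j) P_j n̂₀^{-1/2} g + Λ_n†(∂_{j,a} g)` for periodic `C¹` `g` (`L > 0`).
[folklore] -/
theorem bareSecondVariation_fderiv_lnssUpper :
    ∀ (m : ℕ) (L : ℝ), 0 < L → ∀ (n : Fin 3 → ℤ) (j : Fin (m + 1)) (a : Fin 3)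
      (g : Literature.MathematicalPhysics.QuantumManyBody.BoseGas.Config (m + 1) → ℂ),
      ContDiff ℝ 1 g →
      (∀ (X : Literature.MathematicalPhysics.QuantumManyBody.BoseGas.Config (m + 1)) (i : Fin (m + 1))
          (k : Fin 3), g (X + Pi.single i (EuclideanSpace.single k L)) = g X) →
      ∀ X : Literature.MathematicalPhysics.QuantumManyBody.BoseGas.Config (m + 1),
        fderiv ℝ (lnssUpper m L n g) X (Pi.single j (EuclideanSpace.single a (1 : ℝ))) =
          (2 * Real.pi * Complex.I * (n a) / L) *
              (Literature.MathematicalPhysics.QuantumManyBody.BoseGas.cellWave L n (X j) *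
                Summit.AtomisticToContinuum.BoseEinsteinCondensation.Theorems.GaussianDominationCan.Negative.cellAvg
                  (m + 1) L j (rootInv m L g) X) +
            lnssUpper m L n (fun Y => fderiv ℝ g Y (Pi.single j (EuclideanSpace.single a (1 : ℝ)))) X :=
  fun _ _ hL n j a _ hg hper X => SecondVariation.fderiv_lnssUpper_single hL n j a hg hper X

end Summit.AtomisticToContinuum.BoseEinsteinCondensation.Cruxes.GDTransfer.DysonDressedWitness

end
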